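import Literature.NumberTheory.Transcendental.RoySmallValueInterpolationIso
import Literature.NumberTheory.Transcendental.RoySmallValueVanishing
import HarnessLib

/-!
# Roy's small value estimate for `𝔾ₐ × 𝔾ₘ` — Lemma 3.5 (the division step)

Topic `Literature/NumberTheory/Transcendental`. Part of the formalisation of the proof of Roy 2013,
Theorem 1.1 (named fact `roy2013_thm_1_1`, `RoySmallValueEstimates.lean`). Source: D. Roy,
*A small value estimate for `𝔾ₐ × 𝔾ₘ`*, Mathematika 59 (2013) 333–363 = arXiv:1301.0663, §3,
Lemma 3.5 (p. 9 of the arXiv text):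

> **Lemma 3.5.** Let `γ = (ξ, η) ∈ 𝒢`, let `K, L, N, T ∈ ℕ` with
> `binom(L+1, 2) < T ≤ binom(L+2, 2)` and `L < K ≤ N ≤ min{2K - L, (3K+2)/2}`, and let
> `Q ∈ I_N^{(γ,T)}`. Then `Q = ∑_{j=0}^{2} X_j^{N-K} Q_j` for a choice of `Q_j ∈ I_K^{(γ,T)}`
> (`j = 0, 1, 2`) satisfying `∑ 𝓛(Q_j) ≤ c₃(γ)^K (64K)^T 𝓛(Q)`, `c₃(γ) = c₁(-γ)c₂(γ)`.

`lemma_3_5` below is this statement, proved exactly as printed (monomial partition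
`Q = ∑ X_j^{N-K} P_j`; interpolants `R₁, R₂ ∈ ℂ[X]_L` from Proposition 3.3 reproducing the first
`T` derivatives of `P₁, P₂` at `(1, γ)` and killing the next `M - T`;
`Q₀ = P₀ + X₀^{2K-L-N}(X₁^{N-K}R₁ + X₂^{N-K}R₂)`, `Q_j = P_j - X₀^{K-L}R_j`), with
"`Q ∈ I_N^{(γ,T)}`" rendered as `Q ∈ ℂ[X]_N`, `Q ∈ vanIdeal ξ η T` (see
`RoySmallValueVanishing.lean`) and with the constant `c₃^K (64K)^T` replaced by
`3 (c₁' c₂)^K (16K³)^T`, `c₁' = 3(1 + |ξ| + |η|⁻¹)`, `c₂ = max{1, |ξ|, |η|}`, reflecting the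
constant of our Proposition 3.3 (only the shape `c(γ)^K K^{O(T)}` is used in Proposition 3.7).
The membership `Q₀ ∈ I^{(γ,T)}` is obtained from `X₀^{N-K}Q₀ = Q - X₁^{N-K}Q₁ - X₂^{N-K}Q₂` and
`X_zero_pow_mul_mem_vanIdeal_iff` (in place of the primary decomposition of Corollary 3.4).

Everything here is proved; no definitions, no new named facts.

## References

* [Roy2013] D. Roy, *A small value estimate for 𝔾ₐ × 𝔾ₘ*, Mathematika 59 (2013), 333–363
  (arXiv:1301.0663), §3, Lemma 3.5.
-/

noncomputable section

open MvPolynomial Finset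

namespace Literature.NumberTheory.Transcendental

namespace Roy2013

open Nesterenko

/-! ### Binomial bookkeeping: `M ≤ 2T - 1` -/

/-- `binom(L+2, 2) = (L+1) + binom(L+1, 2)`. [folklore] -/
theorem choose_two_succ (L : ℕ) : (L + 2).choose 2 = (L + 1) + (L + 1).choose 2 := by
  rw [Nat.choose_succ_succ, Nat.choose_one_right]

/-- `L ≤ binom(L+1, 2)`. [folklore] -/
theorem le_choose_two (L : ℕ) : L ≤ (L + 1).choose 2 := by
  induction L with
  | zero => simp
  | succ L ih => rw [choose_two_succ]; omega

/-- "As `M ≤ 2 binom(L+1,2) + 1 ≤ 2T - 1`": `binom(L+2, 2) + 1 ≤ 2T` when `binom(L+1, 2) < T`.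
[cite: Roy2013, §3, proof of Lemma 3.5] -/
theorem choose_two_succ_le_two_mul {L T : ℕ} (hT : (L + 1).choose 2 < T) :
    (L + 2).choose 2 + 1 ≤ 2 * T := by
  have := le_choose_two L
  rw [choose_two_succ]
  omega

/-! ### Lemma 3.5 -/

/-- **Roy 2013, Lemma 3.5** (division step). Let `γ = (ξ, η)` with `η ≠ 0`, `K, L, N, T ∈ ℕ`
with `binom(L+1,2) < T ≤ binom(L+2,2)`, `L < K ≤ N ≤ min{2K - L, (3K+2)/2}`, and let
`Q ∈ I_N^{(γ,T)}` (i.e. `Q ∈ ℂ[X]_N ∩ vanIdeal ξ η T`). Then `Q = ∑_{j} X_j^{N-K} Q_j` with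
`Q_j ∈ I_K^{(γ,T)}` and `𝓛(Q₀) + 𝓛(Q₁) + 𝓛(Q₂) ≤ 3 (c₁'c₂)^K (16K³)^T 𝓛(Q)`
(`c₁' = 3(1 + |ξ| + |η|⁻¹)`, `c₂ = max{1, |ξ|, |η|}`; Roy: `≤ c₃^K (64K)^T 𝓛(Q)`).
[cite: Roy2013, Lemma 3.5] -/
theorem lemma_3_5 {ξ η : ℂ} (hη : η ≠ 0) {K L N T : ℕ} (hT₁ : (L + 1).choose 2 < T)
    (hT₂ : T ≤ (L + 2).choose 2) (hLK : L < K) (hKN : K ≤ N) (hN₁ : N + L ≤ 2 * K)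
    (hN₂ : 2 * N ≤ 3 * K + 2) {Q : CX} (hQ : Q.IsHomogeneous N) (hQv : Q ∈ vanIdeal ξ η T) :
    ∃ Q₀ Q₁ Q₂ : CX, (Q₀.IsHomogeneous K ∧ Q₁.IsHomogeneous K ∧ Q₂.IsHomogeneous K) ∧
      (Q₀ ∈ vanIdeal ξ η T ∧ Q₁ ∈ vanIdeal ξ η T ∧ Q₂ ∈ vanIdeal ξ η T) ∧
      X 0 ^ (N - K) * Q₀ + X 1 ^ (N - K) * Q₁ + X 2 ^ (N - K) * Q₂ = Q ∧
      l1Norm Q₀ + l1Norm Q₁ + l1Norm Q₂ ≤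
        3 * (3 * (1 + ‖ξ‖ + ‖η‖⁻¹) * max 1 (max ‖ξ‖ ‖η‖)) ^ K * (16 * (K : ℝ) ^ 3) ^ T *
          l1Norm Q := by
  classical
  -- constants
  set M : ℕ := (L + 2).choose 2 with hM
  set A : ℝ := 3 * (1 + ‖ξ‖ + ‖η‖⁻¹) with hA
  set c₂ : ℝ := max 1 (max ‖ξ‖ ‖η‖) with hc₂
  have hA1 : 1 ≤ A := by
    have h1 : 0 ≤ ‖ξ‖ := norm_nonneg _
    have h2 : 0 ≤ ‖η‖⁻¹ := inv_nonneg.mpr (norm_nonneg _)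
    rw [hA]; linarith
  have hc₂1 : 1 ≤ c₂ := le_max_left _ _
  have hK1 : (1 : ℝ) ≤ K := by exact_mod_cast (show 1 ≤ K by omega)
  have hMT : M ≤ 2 * T := by have := choose_two_succ_le_two_mul hT₁; omega
  -- Step 1: monomial partition `Q = ∑ X_j^{N-K} P_j`
  obtain ⟨P, hPh, hPsum, hPlen⟩ :=
    exists_partition_X_pow (N := N) (a := N - K) (by omega) (by omega) hQ
  have hNa : N - (N - K) = K := by omega
  simp only [hNa] at hPh
  rw [Fin.sum_univ_three] at hPsum hPlen
  -- Step 2: the interpolants `R_j ∈ ℂ[X]_L`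
  set W : ℝ := A ^ L * (4 * (L + 1) : ℝ) ^ M * (c₂ ^ K * (K : ℝ) ^ T) with hW
  have hR : ∀ j : Fin 3, ∃ R : CX, R.IsHomogeneous L ∧
      (∀ i < T, aeval ![1, ξ, η] (homD^[i] R) = aeval ![1, ξ, η] (homD^[i] (P j))) ∧
      l1Norm R ≤ W * l1Norm (P j) := by
    intro j
    have hB : ∀ n < (L + 2).choose 2,
        ‖(fun i => if i < T then aeval ![1, ξ, η] (homD^[i] (P j)) else 0) n‖ ≤
          c₂ ^ K * (K : ℝ) ^ T * l1Norm (P j) := by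
      intro n _
      dsimp only
      split_ifs with h
      · refine (norm_aeval_iterate_homD_le (hPh j) ξ η n).trans ?_
        refine mul_le_mul_of_nonneg_right (mul_le_mul_of_nonneg_left ?_ (by positivity))
          (l1Norm_nonneg _)
        exact pow_le_pow_right₀ hK1 h.le
      · rw [norm_zero]
        exact mul_nonneg (by positivity) (l1Norm_nonneg _)
    obtain ⟨R, hRh, hRv, hRl⟩ := exists_isHomogeneous_iterate_homD_eq_of_norm_le L hη _ hB
    refine ⟨R, hRh, fun i hi => ?_, ?_⟩
    · rw [hRv i (by omega)]
      exact if_pos hi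
    · rw [hW]
      convert hRl using 1
      ring
  choose R hRh hRv hRl using hR
  -- Step 3: the new polynomials
  set Q₁ : CX := P 1 - X 0 ^ (K - L) * R 1 with hQ₁
  set Q₂ : CX := P 2 - X 0 ^ (K - L) * R 2 with hQ₂
  set Q₀ : CX := P 0 + X 0 ^ (2 * K - L - N) * (X 1 ^ (N - K) * R 1 + X 2 ^ (N - K) * R 2)
    with hQ₀
  have hx : (X 0 : CX) ^ (N - K) * X 0 ^ (2 * K - L - N) = X 0 ^ (K - L) := by
    rw [← pow_add]; congr 1; omega
  have hsum : X 0 ^ (N - K) * Q₀ + X 1 ^ (N - K) * Q₁ + X 2 ^ (N - K) * Q₂ = Q := by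
    calc X 0 ^ (N - K) * Q₀ + X 1 ^ (N - K) * Q₁ + X 2 ^ (N - K) * Q₂
        = (X 0 ^ (N - K) * P 0 + X 1 ^ (N - K) * P 1 + X 2 ^ (N - K) * P 2) +
            ((X 0 : CX) ^ (N - K) * X 0 ^ (2 * K - L - N)) *
              (X 1 ^ (N - K) * R 1 + X 2 ^ (N - K) * R 2) -
            X 0 ^ (K - L) * (X 1 ^ (N - K) * R 1 + X 2 ^ (N - K) * R 2) := by
          rw [hQ₀, hQ₁, hQ₂]; ring
      _ = Q := by rw [hx, hPsum]; ring
  -- homogeneity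
  have hQ₁h : Q₁.IsHomogeneous K := by
    have h := (isHomogeneous_X_pow (R := ℂ) (0 : Fin 3) (K - L)).mul (hRh 1)
    rw [show K - L + L = K by omega] at h
    exact (homogeneousSubmodule (Fin 3) ℂ K).sub_mem (hPh 1) h
  have hQ₂h : Q₂.IsHomogeneous K := by
    have h := (isHomogeneous_X_pow (R := ℂ) (0 : Fin 3) (K - L)).mul (hRh 2)
    rw [show K - L + L = K by omega] at h
    exact (homogeneousSubmodule (Fin 3) ℂ K).sub_mem (hPh 2) h
  have hQ₀h : Q₀.IsHomogeneous K := by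
    have h1 := (isHomogeneous_X_pow (R := ℂ) (1 : Fin 3) (N - K)).mul (hRh 1)
    have h2 := (isHomogeneous_X_pow (R := ℂ) (2 : Fin 3) (N - K)).mul (hRh 2)
    have h := (isHomogeneous_X_pow (R := ℂ) (0 : Fin 3) (2 * K - L - N)).mul (h1.add h2)
    rw [show 2 * K - L - N + (N - K + L) = K by omega] at h
    exact (homogeneousSubmodule (Fin 3) ℂ K).add_mem (hPh 0) h
  -- membership in `vanIdeal`
  have hQ₁v : Q₁ ∈ vanIdeal ξ η T := fun i hi => by
    rw [hQ₁, iterate_homD_sub, map_sub, iterate_homD_X_zero_pow_mul, aeval_one_X_zero_pow_mul,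
      hRv 1 i hi, sub_self]
  have hQ₂v : Q₂ ∈ vanIdeal ξ η T := fun i hi => by
    rw [hQ₂, iterate_homD_sub, map_sub, iterate_homD_X_zero_pow_mul, aeval_one_X_zero_pow_mul,
      hRv 2 i hi, sub_self]
  have hQ₀v : Q₀ ∈ vanIdeal ξ η T := by
    rw [← X_zero_pow_mul_mem_vanIdeal_iff (N - K)]
    have : X 0 ^ (N - K) * Q₀ = Q - X 1 ^ (N - K) * Q₁ - X 2 ^ (N - K) * Q₂ := by
      rw [← hsum]; ring
    rw [this]
    exact Ideal.sub_mem _ (Ideal.sub_mem _ hQv (Ideal.mul_mem_left _ _ hQ₁v))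
      (Ideal.mul_mem_left _ _ hQ₂v)
  refine ⟨Q₀, Q₁, Q₂, ⟨hQ₀h, hQ₁h, hQ₂h⟩, ⟨hQ₀v, hQ₁v, hQ₂v⟩, hsum, ?_⟩
  -- Step 4: lengths
  have hS : l1Norm (X 1 ^ (N - K) * R 1 + X 2 ^ (N - K) * R 2) ≤ l1Norm (R 1) + l1Norm (R 2) :=
    (l1Norm_add_le (X 1 ^ (N - K) * R 1) (X 2 ^ (N - K) * R 2)).trans
      (add_le_add (l1Norm_X_pow_mul_le 1 (N - K) (R 1)) (l1Norm_X_pow_mul_le 2 (N - K) (R 2)))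
  have hS' : l1Norm (X 0 ^ (2 * K - L - N) * (X 1 ^ (N - K) * R 1 + X 2 ^ (N - K) * R 2)) ≤
      l1Norm (R 1) + l1Norm (R 2) :=
    (l1Norm_X_pow_mul_le 0 (2 * K - L - N) _).trans hS
  have hl₀ : l1Norm Q₀ ≤ l1Norm (P 0) + (l1Norm (R 1) + l1Norm (R 2)) :=
    (l1Norm_add_le (P 0) _).trans (add_le_add le_rfl hS')
  have hl₁ : l1Norm Q₁ ≤ l1Norm (P 1) + l1Norm (R 1) :=
    (l1Norm_sub_le (P 1) (X 0 ^ (K - L) * R 1)).trans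
      (add_le_add le_rfl (l1Norm_X_pow_mul_le 0 (K - L) (R 1)))
  have hl₂ : l1Norm Q₂ ≤ l1Norm (P 2) + l1Norm (R 2) :=
    (l1Norm_sub_le (P 2) (X 0 ^ (K - L) * R 2)).trans
      (add_le_add le_rfl (l1Norm_X_pow_mul_le 0 (K - L) (R 2)))
  have hW1 : 1 ≤ W := by
    rw [hW]
    have h1 : (1 : ℝ) ≤ A ^ L := one_le_pow₀ hA1
    have h2 : (1 : ℝ) ≤ (4 * (L + 1) : ℝ) ^ M := one_le_pow₀ (by linarith)
    have h3 : (1 : ℝ) ≤ c₂ ^ K := one_le_pow₀ hc₂1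
    have h4 : (1 : ℝ) ≤ (K : ℝ) ^ T := one_le_pow₀ hK1
    calc (1 : ℝ) = 1 * 1 * (1 * 1) := by ring
      _ ≤ A ^ L * (4 * (L + 1) : ℝ) ^ M * (c₂ ^ K * (K : ℝ) ^ T) := by gcongr
  have hW2 : W ≤ (A * c₂) ^ K * (16 * (K : ℝ) ^ 3) ^ T := by
    rw [hW]
    have h1 : A ^ L ≤ A ^ K := pow_le_pow_right₀ hA1 hLK.le
    have h2 : (4 * (L + 1) : ℝ) ^ M ≤ (4 * K : ℝ) ^ (2 * T) := by
      calc (4 * (L + 1) : ℝ) ^ M ≤ (4 * K : ℝ) ^ M := by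
            refine pow_le_pow_left₀ (by positivity) ?_ _
            have : (L : ℝ) + 1 ≤ K := by exact_mod_cast hLK
            linarith
        _ ≤ (4 * K : ℝ) ^ (2 * T) := pow_le_pow_right₀ (by linarith) hMT
    calc A ^ L * (4 * (L + 1) : ℝ) ^ M * (c₂ ^ K * (K : ℝ) ^ T)
        ≤ A ^ K * (4 * K : ℝ) ^ (2 * T) * (c₂ ^ K * (K : ℝ) ^ T) := by gcongr
      _ = (A * c₂) ^ K * (16 * (K : ℝ) ^ 3) ^ T := by
          clear_value A c₂
          rw [mul_pow, mul_pow, pow_mul]; ring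
  have hP0 : 0 ≤ l1Norm (P 0) := l1Norm_nonneg _
  have hP1 : 0 ≤ l1Norm (P 1) := l1Norm_nonneg _
  have hP2 : 0 ≤ l1Norm (P 2) := l1Norm_nonneg _
  have hQ0 : 0 ≤ l1Norm Q := l1Norm_nonneg _
  calc l1Norm Q₀ + l1Norm Q₁ + l1Norm Q₂
      ≤ (l1Norm (P 0) + l1Norm (P 1) + l1Norm (P 2)) + 2 * (l1Norm (R 1) + l1Norm (R 2)) := by
        linarith
    _ ≤ l1Norm Q + 2 * (W * l1Norm (P 1) + W * l1Norm (P 2)) := by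
        linarith [hRl 1, hRl 2]
    _ ≤ l1Norm Q + 2 * (W * l1Norm Q) := by nlinarith
    _ ≤ 3 * W * l1Norm Q := by nlinarith
    _ ≤ 3 * ((A * c₂) ^ K * (16 * (K : ℝ) ^ 3) ^ T) * l1Norm Q := by gcongr
    _ = 3 * (A * c₂) ^ K * (16 * (K : ℝ) ^ 3) ^ T * l1Norm Q := by ring

end Roy2013

end Literature.NumberTheory.Transcendental
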